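import Literature.NumberTheory.EllipticCurves.KummerSelmerStructure
import HarnessLib

/-!
# KOLY method line, crux stmt-BirchSwinnertonDyer-19574 `ZhangSharpFrameAtThreeHL`, stub S2-ENGINE: the GENUINE local
# ordinary condition in the Poitou–Tate model (cell `bsd-stepL`, ACCEL seat `bsd-stepL-koly3b` g6;
# `--supports stmt-BirchSwinnertonDyer-19574`, helper; definition lane)

WHY. The (J) half of S2-ENGINE's (Supply) binder (`ZhangSupply.hjump_of_localLagrangians`, part XVIII, p517552) asks,
above every good unipotent-admissible prime `q` of the level, for a LOCAL condition `Lord v ≤ H¹(K_v, E[3])` in the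
Poitou–Tate model (`galoisCohomology (ρ.toLocal (Sum.inr v)) 1`) that is isotropic for the local Weil cup product, has
`#Lord v · #Lord v = #H¹(K_v, E[3])`, and whose preimage under the localisation lies in the tree's GLOBAL-currency
ordinary condition `WeierstrassCurve.ordinaryLocalKer` (Literature `OrdinaryLocalCondition.lean`: the classes of
`H¹(K, E[n])` whose localisation is represented by a cocycle valued in the `Γ_{K_v}`-fixed torsion points). The
Poitou–Tate counting (Milne I Thm. 4.10 for Selmer STRUCTURES) needs the condition as a subgroup of the LOCAL group;
this file types it: `Method2.ordinaryLocalCondition E L n ≤ H¹(Γ_L, E[n](K̄)|_{Γ_L})` for a Weierstrass curve `E/K`, a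
`K`-field `L` (a completion) and `n : ℤ` — the classes represented by a continuous cocycle of the restricted module all of
whose values are `Γ_L`-invariant (= the image of `H¹(Γ_L, E[n]^{Γ_L}) → H¹(Γ_L, E[n])`; Bertolini–Darmon's
`H¹_ord(K_q, E[p]) = im H¹(K_q, F⁺)` at a (unipotent-)admissible prime, where the invariants are the toric line).
The dictionary `x ∈ ordinaryLocalKer ⟺ res x ∈ ordinaryLocalCondition`, the isotropy and the counts are proved in the
companion proof file `KolyvaginRoadThreeZhangSupplyOrdinaryLagrangian.lean`.

HONEST FRAMING: one definition with body + its unfolding lemma; 0 named facts, 0 `sorry`, no instance, no notation;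
nothing is asserted; closes nothing (T7). PARTITION: O2@3 (B10) × A1 × crux 19574 × stub S2-ENGINE — types-the-object-of.

References: [cite: BertoliniDarmon2005, §2.2–§2.3 (H¹_ord at admissible primes)] [cite: WZhang2014, §4.1 (H¹_ord)]
[cite: SerreGaloisCohomology1997, I.§5.1 (classes by cocycle representatives)].
-/

noncomputable section

open scoped Classical

universe u

namespace Summit.BirchSwinnertonDyer.Rank1Residual.X11b.Three.Koly.Method2

open CategoryTheory WeierstrassCurve Field Function NumberField IsDedekindDomain
open Literature.NumberTheory.EllipticCurves Literature.NumberTheory.GaloisRepresentations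

section Defs

variable {K : Type u} [Field K] (E : WeierstrassCurve K) (L : Type u) [Field L] [Algebra K L]

/-- **The GENUINE local ordinary condition** at a `K`-field `L` (a completion `K_v`), in the Poitou–Tate model
`H¹(Γ_L, E[n](K̄)|_{Γ_L})` (`galoisCohomology (GaloisRep.restrictField L (E.torsionGaloisModule n)) 1`, which is
`galoisCohomology ((E.torsionGaloisModule n).toLocal (Sum.inr v)) 1` for `L = K_v` by `rfl`): the local classes
represented by a continuous cocycle ALL of whose values are `Γ_L`-invariant points of `E[n](K̄)` — i.e. the image of
`H¹(Γ_L, E[n]^{Γ_L}) → H¹(Γ_L, E[n])`, Bertolini–Darmon's `H¹_ord(K_q, E[p]) = im H¹(K_q, F⁺)` at a (unipotent-)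
admissible prime, where `E[p]^{Γ_{K_q}}` is the toric line. Companion of the tree's GLOBAL-currency
`WeierstrassCurve.ordinaryLocalKer` (= its preimage under the localisation:
`ZhangSupply.mem_ordinaryLocalKer_iff_localization_mem_ordinaryLocalCondition`). A definition; nothing asserted.
[cite: BertoliniDarmon2005, §2.2–§2.3 (H¹_ord)] [cite: WZhang2014, §4.1 (H¹_ord)] -/
def ordinaryLocalCondition (n : ℤ) :
    AddSubgroup (galoisCohomology (GaloisRep.restrictField L (E.torsionGaloisModule n)) 1) where
  carrier := {a | ∃ ψ : contOneCocycles
      (DiscreteGaloisModule.toTopRep (GaloisRep.restrictField L (E.torsionGaloisModule n))),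
    (∀ σ τ : absoluteGaloisGroup L, absGaloisRestrict K L τ • ψ.1 σ = ψ.1 σ) ∧ oneCocycleClass _ ψ = a}
  zero_mem' := ⟨0, fun _ _ ↦ by change absGaloisRestrict K L _ • (0 : geomTorsion E n) = 0; exact smul_zero _,
    oneCocycleClass_zero _⟩
  add_mem' := by
    rintro a b ⟨φ, hφ, rfl⟩ ⟨ψ, hψ, rfl⟩
    refine ⟨φ + ψ, fun σ τ ↦ ?_, oneCocycleClass_add _ φ ψ⟩
    change absGaloisRestrict K L τ • (φ.1 σ + ψ.1 σ) = φ.1 σ + ψ.1 σ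
    rw [smul_add, hφ, hψ]
  neg_mem' := by
    rintro a ⟨φ, hφ, rfl⟩
    refine ⟨-φ, fun σ τ ↦ ?_, ?_⟩
    · change absGaloisRestrict K L τ • (-(φ.1 σ)) = -(φ.1 σ)
      rw [smul_neg, hφ]
    · have h := oneCocycleClass_sub _ (0 : contOneCocycles _) φ
      rw [zero_sub, oneCocycleClass_zero, zero_sub] at h
      exact h

variable {E L} in
/-- Membership in the genuine local ordinary condition (definitional). [cite: BertoliniDarmon2005, §2.2 (H¹_ord)] -/
theorem mem_ordinaryLocalCondition_iff {n : ℤ}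
    {a : galoisCohomology (GaloisRep.restrictField L (E.torsionGaloisModule n)) 1} :
    a ∈ ordinaryLocalCondition E L n ↔ ∃ ψ : contOneCocycles
      (DiscreteGaloisModule.toTopRep (GaloisRep.restrictField L (E.torsionGaloisModule n))),
      (∀ σ τ : absoluteGaloisGroup L, absGaloisRestrict K L τ • ψ.1 σ = ψ.1 σ) ∧ oneCocycleClass _ ψ = a :=
  Iff.rfl

end Defs

end Summit.BirchSwinnertonDyer.Rank1Residual.X11b.Three.Koly.Method2

end
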